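import Summits.Langlands.Langlands.Theses.SkinnerWilesDefectOne
import Summits.Langlands.Langlands.Theorems.ProModularOrdinaryClassical.Negative.LoadBearing
import Literature.NumberTheory.Automorphic.OrdinaryCompletedCohomologyGL

/-!
# Line `top-degree-exact-control` for the crux `SkinnerWilesDefectOne.ProModularOrdinaryClassical`
(stmt-Langlands-12921, THE EXIT) — LEAD'S SKELETON (rev 2, prover-line-stmt-Langlands-12921-0, 2026-08-16;
reshaped from the planner's `Lines/top-degree-exact-control.lean`, card `Lines/top-degree-exact-control.md`,
idea `Ideas/top-degree-exact-control.md`, triage `TRIAGE-r1-{1,2,3}.md`: pass ×3).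

**Idea.** A characteristic-0 point `x` of Hida's ORDINARY big Hecke algebra `𝕋^{S,ord}(𝒰)`
(`OrdinaryHeckeAlgebraGLn 𝒰`, constructed in the tree) whose diamond character is the DOMINANT
arithmetic character of parallel weight `k ≥ 2` is classical, with NO torsion-freeness input
(Khare–Thorne's perfect `Λ`-complex of the Bianchi Hida tower is exact in the top degree; Nakayama at the
characteristic-0 prime `𝔭_x ⊇ P_k`; Franke/Harder).  What separates this from the crux is (OF)
Galois-ordinary ⇒ Hecke-ordinary (`stub_ordinaryFactorisation`, the TRANSFER slot = the crux's open core,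
shared with every line) and the diamond character at `x` (total exponent: `stub_centralDiamondWeight`;
ordering: `stub_slotZeroDiamondWeight`).  The last stub (`stub_satakeDictionary`) is the unramified
dictionary `𝕋^{ord}`-association (arithmetic Frobenius, `heckeFrobPoly`) ↔ the summit's
`SatakeFrobCompatibleAt` (`arithFrobPolyOfSatake ι q 1 α`): `π = π₀^∨ ⊗ |det|^{1/2}`, L-algebraic.

**Rev 2 reshape (lead).** (a) Every registered stub is now a CLOSED, FULLY QUALIFIED one-line statement
(no `S.stub_*` abbreviation), so that a Theorems-side `--supports stmt-Langlands-12921` file can restate it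
byte-for-byte (Cruxes modules are not importable from `Theorems/`).  (b) The planner's
`stub_dominantDiamondWeight` is split at the skeleton level into its two mathematically distinct halves —
`stub_centralDiamondWeight` (the CENTRE of the diamond character is `N_{F/ℚ}(u)^{2-k}` up to `N`-th
powers: provable from association + triviality of global central elements on `H^•(GL₂(F), ·)` + a
finite-order statement for `det ρ · ε^{1-k}`, card §Conventions (i)) and `stub_slotZeroDiamondWeight`
(slot `0` has finite order: the ORDERING bit, the line's open core proper, card §Conventions (ii)) — glued
by the pure-algebra stub `stub_dominantOfCentralAndSlotZero` (proved by the lead; it lands together with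
the interface predicate `HasDominantDiamondWeight` in
`Theorems/SkinnerWilesDefectOneProModularOrdinaryClassicalDefs.lean`, declared in THIS namespace so that
registered signatures read identically on both sides).  Composition unchanged otherwise:
`ProModularOrdinaryClassical_of : stub1 → stub2a → stub2b → glue → stub3 → stub4 → crux` (pure logic).

**Disproof used** (`Cruxes/ProModularOrdinaryClassical/Disproof.lean`, cdisprove gen 1 cycle 1, re-read
2026-08-16T02:30Z by the lead; no `¬`-theorem, no `_false_without_` theorem exists): §0
`crux_of_ordinaryFontaineMazur` — the line USES `hpm`, in `stub_ordinaryFactorisation` only; §1c `0 < m`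
and §1d `2 ≤ k` — hypotheses of stubs 2a/2b/3; §1e irreducibility — hypothesis of stubs 2b and 3; §1a
`hunr` — passed to stub 1 only (landed `eventually_isUnramifiedAt_of_isPadicallyAutomorphic`, re-derived
in `hunr_redundant`).  Negatives index: 1 unrelated entry.
-/

namespace Summit.Langlands.Langlands.Cruxes.ProModularOrdinaryClassical.TopDegreeExactControl

set_option linter.dupNamespace false
set_option linter.unusedVariables false

open Summit.Langlands.Langlands.Theses.SkinnerWilesDefectOne
open Summit.Langlands.Langlands.Theorems.ProModularOrdinaryClassical.Negative
open Literature.NumberTheory.Automorphic Literature.NumberTheory.GaloisRepresentations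
open Literature.NumberTheory.Automorphic.BigHeckeGLn
open NumberField IsDedekindDomain Filter
open scoped BigOperators

noncomputable section

/-! ## 0. The interface predicate: dominant diamond weight of a `ℚ̄_p`-point of `𝕋^{S,ord}(𝒰)`
(lands verbatim, same namespace, in `Theorems/SkinnerWilesDefectOneProModularOrdinaryClassicalDefs.lean`;
the local copy is deleted when that file is in the tree) -/

/-- **`x` has DOMINANT diamond weight `k` (parallel).**  For the `ℚ̄_p`-point `x` of the ordinary
big Hecke algebra `𝕋^{S,ord}(𝒰)` of `GL₂/F`: there is `N ≥ 1` such that for every global `u ∈ 𝓞 F`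
that is a unit at every `v ∣ p` (`û_v ∈ 𝒪_vˣ` its images), the product over `v ∣ p` of the diamond
eigenvalues `x(⟨diag(1, û_v)⟩_v)` equals `N_{F/ℚ}(u)^{2-k}` up to `N`-th powers, and the product of
the `x(⟨diag(û_v, 1)⟩_v)` is an `N`-th root of unity — i.e. (global `u` prime to `p` being dense in
`∏_{v ∣ p} 𝒪_vˣ`, and `u ↦ x(⟨u⟩_v)` being continuous) at every `v ∣ p` the SECOND diagonal slot of the
diamond character is `Nm_{F_v/ℚ_p}^{2-k} ·` (finite order) and the FIRST has finite order: the algebraic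
type `(0, 2-k)` of CLASSICAL parallel-weight-`k` ordinary eigenforms in the tree's conventions (Hida levels
are UPPER-triangular Iwahori, `U_{v,1} = [U(r) diag(ϖ_v, 1) U(r)]`, Hecke operators of normalising
elements are RIGHT translations, `heckeFrobPoly 2 q a = X² − a₁ X + q a₂` with arithmetic Frobenius), as
opposed to the companion type `{1, 1-k}` and to non-arithmetic weights; see the line card §Conventions
for the derivation of the slot and of the total exponent. [cite: KhareThorne2017, §6.3 and §6.5]
[cite: Hida1994AIF] [cite: SkinnerWiles1999, §3 (3.4)] -/
def HasDominantDiamondWeight {F : Type} [Field F] [NumberField F] {p : ℕ} [Fact p.Prime]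
    (𝒰 : TameLevel 2 F p) (x : OrdinaryHeckeAlgebraGLn 𝒰 →+* PadicAlgCl p) (k : ℕ) : Prop :=
  ∃ N : ℕ, 0 < N ∧
    ∀ (u : 𝓞 F)
      (û : ∀ v : HeightOneSpectrum (𝓞 F), (p : 𝓞 F) ∈ v.asIdeal → (v.adicCompletionIntegers F)ˣ),
      (∀ (v : HeightOneSpectrum (𝓞 F)) (hv : (p : 𝓞 F) ∈ v.asIdeal),
          ((û v hv : v.adicCompletionIntegers F) : v.adicCompletion F) =
            algebraMap F (v.adicCompletion F) (u : F)) →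
      (∏ᶠ v : {v : HeightOneSpectrum (𝓞 F) // (p : 𝓞 F) ∈ v.asIdeal},
          x (𝒰.ordDiamond v.2 (Pi.mulSingle (1 : Fin 2) (û v.1 v.2)))) ^ N =
        (((Algebra.norm ℤ u : ℤ) : PadicAlgCl p) ^ (2 - (k : ℤ))) ^ N ∧
      (∏ᶠ v : {v : HeightOneSpectrum (𝓞 F) // (p : 𝓞 F) ∈ v.asIdeal},
          x (𝒰.ordDiamond v.2 (Pi.mulSingle (0 : Fin 2) (û v.1 v.2)))) ^ N = 1

/-! ## 1. The six registered stubs (the ONLY `sorry`s of the file; each a closed, fully qualified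
statement, restated byte-for-byte by its Theorems-side proof) -/

/-- **Stub 1 — (OF) ordinary factorisation (TRANSFER slot; the crux's open core, shared with the lines
`paskunas-centre-split` (split `p ≥ 5`) and `ordinary-patching-by-regime`).**  Under the crux's hypotheses
(irreducible, a.e. unramified, `p`-adically automorphic of some tame level, ordinary of one parallel weight
`k ≥ 2` with exponent `m > 0` at every `v ∣ p`), `ρ` is ORDINARILY `p`-adically automorphic of some tame
level maximal above `p`: associated with a continuous `ℚ̄_p`-point of Hida's `𝕋^{S,ord}(𝒰)`.  This is
where `hpm` is consumed (Disproof §0). Size XL (open: crux NOTES §1, NegativeNotes B0).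
[cite: CaraianiNewton2023, Thm. 4.2.15] [cite: KhareThorne2017, §6.5, Conj. 6.18] -/
theorem stub_ordinaryFactorisation : ∀ (F : Type) [Field F] [NumberField F], NumberField.IsTotallyComplex F → Module.finrank ℚ F = 2 → ∀ (p : ℕ) [Fact p.Prime], p ≠ 2 → ∀ (ρ : Literature.NumberTheory.GaloisRepresentations.FramedGaloisRep F (PadicAlgCl p) 2), ρ.toGaloisRep.IsIrreducible → (∀ᶠ v in Filter.cofinite, ρ.IsUnramifiedAt v) → (∃ 𝒰 : Literature.NumberTheory.Automorphic.BigHeckeGLn.TameLevel 2 F p, 𝒰.IsPadicallyAutomorphic ρ) → (∃ k : ℕ, 2 ≤ k ∧ ∃ m : ℕ, 0 < m ∧ ∀ v : IsDedekindDomain.HeightOneSpectrum (NumberField.RingOfIntegers F), (p : NumberField.RingOfIntegers F) ∈ v.asIdeal → ρ.IsOrdinaryOfWeightAt p v k m) → ∃ 𝒰 : Literature.NumberTheory.Automorphic.BigHeckeGLn.TameLevel 2 F p, 𝒰.IsMaximalAbove ∧ 𝒰.IsOrdinarilyPadicallyAutomorphic ρ := by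
  sorry

/-- **Stub 2a — the CENTRE of the diamond character at `x` has weight `2 - k` (total exponent; card
§Conventions (i)).**  For `𝒰` maximal above `p` and a continuous `ℚ̄_p`-point `x` of `𝕋^{S,ord}(𝒰)`
associated with `ρ` (irreducible, Galois-ordinary of parallel weight `k ≥ 2`, exponent `m > 0`, at every
`v ∣ p`): there is `N ≥ 1` with `(∏_{v ∣ p} x(⟨diag(û_v, û_v)⟩_v))^N = (N_{F/ℚ}(u)^{2-k})^N` for every global
`u ∈ 𝓞 F` that is a unit above `p`.  Intended proof: for `u ≡ 1 mod 𝔫` (`𝔫` the level of `𝒰` at the bad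
places off `p`) the global central `γ = diag(u,u) ∈ GL₂(F)` acts trivially on `H^•(GL₂(F), Fun(G_f/U(r), ·))`
(central elements act trivially on group cohomology) and acts on the coefficients by the right translation
`R_{γ_f⁻¹} = ⟨u⁻¹⟩_p · ∏_{w ∣ u} T_{w,2}^{-v_w(u)}` (Hecke operators of normalising elements are right
translations, `ArithmeticQuotient.heckeFun_apply_mk_of_conj`; `T_{w,2}` is the operator of the central
`diag(ϖ_w, ϖ_w)`), so `⟨u⟩_p = ∏_{w ∣ u} (T_{w,2}⁻¹)^{v_w(u)}` in `𝕋^{S,ord}(𝒰)`; association gives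
`q_w x(T_{w,2}) = det ρ(Frob_w^{arith})`, and `det ρ = ψ ε^{k-1}` with `ψ^m` unramified at `p` (from
`IsOrdinaryOfWeightAt`, `0 < m`) and a.e. unramified, hence of finite order (class field theory: named fact),
so `∏_{v∣p} x(⟨û⟩_v) = N(u)^{2-k} · ζ`, `ζ^N = 1`; general `u` by continuity of `u ↦ ⟨u⟩_v` (locally constant
levelwise) and density of `{u ≡ 1 mod 𝔫}` in `∏_{v ∣ p} 𝒪_vˣ` (CRT). Size L. [cite: KhareThorne2017, §6.3
and §6.5, Conj. 6.18] [cite: SkinnerWiles1999, §3 (3.2)–(3.4)] -/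
theorem stub_centralDiamondWeight : ∀ (F : Type) [Field F] [NumberField F], NumberField.IsTotallyComplex F → Module.finrank ℚ F = 2 → ∀ (p : ℕ) [Fact p.Prime], p ≠ 2 → ∀ (ρ : Literature.NumberTheory.GaloisRepresentations.FramedGaloisRep F (PadicAlgCl p) 2) (𝒰 : Literature.NumberTheory.Automorphic.BigHeckeGLn.TameLevel 2 F p) (x : Literature.NumberTheory.Automorphic.OrdinaryHeckeAlgebraGLn 𝒰 →+* PadicAlgCl p) (k m : ℕ), ρ.toGaloisRep.IsIrreducible → 𝒰.IsMaximalAbove → Continuous x → 𝒰.IsOrdAssociated x ρ → 2 ≤ k → 0 < m → (∀ v : IsDedekindDomain.HeightOneSpectrum (NumberField.RingOfIntegers F), (p : NumberField.RingOfIntegers F) ∈ v.asIdeal → ρ.IsOrdinaryOfWeightAt p v k m) → ∃ N : ℕ, 0 < N ∧ ∀ (u : NumberField.RingOfIntegers F) (û : ∀ v : IsDedekindDomain.HeightOneSpectrum (NumberField.RingOfIntegers F), (p : NumberField.RingOfIntegers F) ∈ v.asIdeal → (v.adicCompletionIntegers F)ˣ), (∀ (v : IsDedekindDomain.HeightOneSpectrum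 (NumberField.RingOfIntegers F)) (hv : (p : NumberField.RingOfIntegers F) ∈ v.asIdeal), ((û v hv : v.adicCompletionIntegers F) : v.adicCompletion F) = algebraMap F (v.adicCompletion F) (u : F)) → (∏ᶠ v : {v : IsDedekindDomain.HeightOneSpectrum (NumberField.RingOfIntegers F) // (p : NumberField.RingOfIntegers F) ∈ v.asIdeal}, x (𝒰.ordDiamond v.2 (fun _ : Fin 2 => û v.1 v.2))) ^ N = (((Algebra.norm ℤ u : ℤ) : PadicAlgCl p) ^ (2 - (k : ℤ))) ^ N := by
  sorry

/-- **Stub 2b — slot `0` of the diamond character at `x` has FINITE ORDER (the ORDERING bit; the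
line's open core proper; card §Conventions (ii), triage r1-2 §B `WeightCharacterAtX`).**  Same hypotheses as
stub 2a: there is `N ≥ 1` with `(∏_{v ∣ p} x(⟨diag(û_v, 1)⟩_v))^N = 1` for every global `u ∈ 𝓞 F` that is a
unit above `p` — i.e. `x` carries the DOMINANT ordering (type `(0, 2-k)`), not the companion one (type
`{1, 1-k}`, a Hecke-ordinary phantom of `p`-adic weight `2 - k` with the same spherical eigensystem, possible
only when `ρ|Γ_{F_v}` splits).  This is ordinary local–global compatibility WITH diamond operators and with
the ORDERING for the `𝕋^{S,ord}_𝔪`-valued determinant over an imaginary quadratic field (one place of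
`F⁺ = ℚ` above `p`: outside CaraianiNewton2023 Thm. 4.2.15 hyp. (1); Eisenstein `𝔪` allowed); no printed
theorem. Uses `0 < m`, `2 ≤ k` (Disproof §1c–d) and irreducibility (§1e). Size L–XL (open).
[cite: CaraianiNewton2023, Thm. 4.2.15] [cite: SkinnerWiles1999, §3 (3.2)–(3.4)] [cite: KhareThorne2017,
§6.5, Conj. 6.18] -/
theorem stub_slotZeroDiamondWeight : ∀ (F : Type) [Field F] [NumberField F], NumberField.IsTotallyComplex F → Module.finrank ℚ F = 2 → ∀ (p : ℕ) [Fact p.Prime], p ≠ 2 → ∀ (ρ : Literature.NumberTheory.GaloisRepresentations.FramedGaloisRep F (PadicAlgCl p) 2) (𝒰 : Literature.NumberTheory.Automorphic.BigHeckeGLn.TameLevel 2 F p) (x : Literature.NumberTheory.Automorphic.OrdinaryHeckeAlgebraGLn 𝒰 →+* PadicAlgCl p) (k m : ℕ), ρ.toGaloisRep.IsIrreducible → 𝒰.IsMaximalAbove → Continuous x → 𝒰.IsOrdAssociated x ρ → 2 ≤ k → 0 < m → (∀ v : IsDedekindDomain.HeightOneSpectrum (NumberField.RingOfIntegers F), (p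 : NumberField.RingOfIntegers F) ∈ v.asIdeal → ρ.IsOrdinaryOfWeightAt p v k m) → ∃ N : ℕ, 0 < N ∧ ∀ (u : NumberField.RingOfIntegers F) (û : ∀ v : IsDedekindDomain.HeightOneSpectrum (NumberField.RingOfIntegers F), (p : NumberField.RingOfIntegers F) ∈ v.asIdeal → (v.adicCompletionIntegers F)ˣ), (∀ (v : IsDedekindDomain.HeightOneSpectrum (NumberField.RingOfIntegers F)) (hv : (p : NumberField.RingOfIntegers F) ∈ v.asIdeal), ((û v hv : v.adicCompletionIntegers F) : v.adicCompletion F) = algebraMap F (v.adicCompletion F) (u : F)) → (∏ᶠ v : {v : IsDedekindDomain.HeightOneSpectrum (NumberField.RingOfIntegers F) // (p : NumberField.RingOfIntegers F) ∈ v.asIdeal}, x (𝒰.ordDiamond v.2 (Pi.mulSingle (0 : Fin 2) (û v.1 v.2)))) ^ N = 1 := by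
  sorry

/-- **Stub 2c (glue) — dominant weight from centre + slot `0` (pure algebra; proved by the lead in
`Theorems/SkinnerWilesDefectOneProModularOrdinaryClassicalDefs.lean`).**  For `𝒰` maximal above `p` (so
that `u ↦ ⟨u⟩_v` is multiplicative, `ordDiamondHom`) and any ring homomorphism `x : 𝕋^{S,ord}(𝒰) → ℚ̄_p`:
if the centre of the diamond character is `N(u)^{2-k}` up to `N₁`-th powers and slot `0` is killed by `N₂`-th
powers, then `HasDominantDiamondWeight 𝒰 x k` (with `N = N₁ N₂`: `diag(û,û) = diag(û,1)·diag(1,û)`). [folklore] -/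
theorem stub_dominantOfCentralAndSlotZero : ∀ (F : Type) [Field F] [NumberField F] (p : ℕ) [Fact p.Prime] (𝒰 : Literature.NumberTheory.Automorphic.BigHeckeGLn.TameLevel 2 F p) (x : Literature.NumberTheory.Automorphic.OrdinaryHeckeAlgebraGLn 𝒰 →+* PadicAlgCl p) (k : ℕ), 𝒰.IsMaximalAbove → (∃ N : ℕ, 0 < N ∧ ∀ (u : NumberField.RingOfIntegers F) (û : ∀ v : IsDedekindDomain.HeightOneSpectrum (NumberField.RingOfIntegers F), (p : NumberField.RingOfIntegers F) ∈ v.asIdeal → (v.adicCompletionIntegers F)ˣ), (∀ (v : IsDedekindDomain.HeightOneSpectrum (NumberField.RingOfIntegers F)) (hv : (p : NumberField.RingOfIntegers F) ∈ v.asIdeal), ((û v hv : v.adicCompletionIntegers F) : v.adicCompletion F) = algebraMap F (v.adicCompletion F) (u : F)) → (∏ᶠ v : {v : IsDedekindDomain.HeightOneSpectrum (NumberField.RingOfIntegers F) // (p : NumberField.RingOfIntegers F) ∈ v.asIdeal}, x (𝒰.ordDiamond v.2 (fun _ : Fin 2 => û v.1 v.2))) ^ N = (((Algebra.norm ℤ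 u : ℤ) : PadicAlgCl p) ^ (2 - (k : ℤ))) ^ N) → (∃ N : ℕ, 0 < N ∧ ∀ (u : NumberField.RingOfIntegers F) (û : ∀ v : IsDedekindDomain.HeightOneSpectrum (NumberField.RingOfIntegers F), (p : NumberField.RingOfIntegers F) ∈ v.asIdeal → (v.adicCompletionIntegers F)ˣ), (∀ (v : IsDedekindDomain.HeightOneSpectrum (NumberField.RingOfIntegers F)) (hv : (p : NumberField.RingOfIntegers F) ∈ v.asIdeal), ((û v hv : v.adicCompletionIntegers F) : v.adicCompletion F) = algebraMap F (v.adicCompletion F) (u : F)) → (∏ᶠ v : {v : IsDedekindDomain.HeightOneSpectrum (NumberField.RingOfIntegers F) // (p : NumberField.RingOfIntegers F) ∈ v.asIdeal}, x (𝒰.ordDiamond v.2 (Pi.mulSingle (0 : Fin 2) (û v.1 v.2)))) ^ N = 1) → HasDominantDiamondWeight 𝒰 x k := by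
  sorry

/-- **Stub 3 — dominant ordinary `ℚ̄_p`-points are classical (the card's lever `OrdinaryPointsClassical` WITH
the ordering hypothesis: exact Hida/Khare–Thorne control in the top ordinary degree + Nakayama at a
characteristic-0 prime, then Franke/Harder).**  For `𝒰` maximal above `p`, a continuous `ℚ̄_p`-point `x` of
`𝕋^{S,ord}(𝒰)` with DOMINANT diamond weight `k ≥ 2`, associated with an irreducible `ρ` (so that `x` is not a
boundary/Eisenstein eigensystem; `ρ` Galois-ordinary of weight `k`, exponent `m > 0`, at `v ∣ p` is carried
along from the crux — the Hecke-side proof does not need it), there is a CUSPIDAL automorphic `π₀` of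
`GL₂(𝔸_F)`, regular algebraic (cohomological of parallel weight `k`), whose Satake parameters `α_w` give the
eigenvalues of `x` at almost all `w`: `ι x(T_{w,1}) = q_w^{1/2} e₁(α_w)`, `ι x(T_{w,2}) = e₂(α_w)` (the
normalisation of `HasSatakeParamAt`).  Internals: KT17 Prop. 6.6 / Cor. 6.8 (minimal perfect `Λ`-complex
`F•_∞` with `F•_∞ ⊗_Λ Λ/𝔞 ≃ C_ord` at finite level, any number field), `H^q_ord = 0` for `q ∉ {1, 2}` at neat
level, top-degree exactness `H²_ord(U(c), V_k) = H²_ord ⊗_Λ Λ/P_k` and the degree-1 edge corrected only by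
`d₂ : Tor₂^Λ(H²_ord, Λ/P_k) → H¹_ord/P_k`, Nakayama at the characteristic-0 prime `𝔭_x ⊇ P_k` (dominant
weight!), torsion killed by `p^a ∉ 𝔭_x`, then Franke/Harder: `H^•(X_U, V_k ⊗ ℂ) =` cuspidal ⊕ boundary,
boundary eigensystems having reducible Galois pseudo-representations, excluded by irreducibility of `ρ`
and Chebotarev/Brauer–Nesbitt. Size XL (named facts to vendor: KT17 control, Borel–Serre finiteness, the
Bianchi Franke/Harder–Eichler–Shimura dictionary). [cite: KhareThorne2017, §6.4, Prop. 6.6 and Cor. 6.8]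
[cite: Harder1987] [cite: Franke1998, Thm. 18] [cite: Hida1994AIF] -/
theorem stub_dominantPointsClassical : ∀ (F : Type) [Field F] [NumberField F], NumberField.IsTotallyComplex F → Module.finrank ℚ F = 2 → ∀ (p : ℕ) [Fact p.Prime], p ≠ 2 → ∀ (hcpt : Literature.NumberTheory.Automorphic.isCompact_glFiniteIntegralLevel 2 F) (ι : PadicAlgCl p ≃+* ℂ) (ρ : Literature.NumberTheory.GaloisRepresentations.FramedGaloisRep F (PadicAlgCl p) 2) (𝒰 : Literature.NumberTheory.Automorphic.BigHeckeGLn.TameLevel 2 F p) (x : Literature.NumberTheory.Automorphic.OrdinaryHeckeAlgebraGLn 𝒰 →+* PadicAlgCl p) (k m : ℕ), ρ.toGaloisRep.IsIrreducible → 𝒰.IsMaximalAbove → Continuous x → 𝒰.IsOrdAssociated x ρ → 2 ≤ k → 0 < m → (∀ v : IsDedekindDomain.HeightOneSpectrum (NumberField.RingOfIntegers F), (p : NumberField.RingOfIntegers F) ∈ v.asIdeal → ρ.IsOrdinaryOfWeightAt p v k m) → HasDominantDiamondWeight 𝒰 x k → ∃ π₀ : Literature.NumberTheory.Automorphic.CuspidalAutomorphicRepData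 2 F hcpt, π₀.1.IsRegularAlgebraic ∧ ∀ᶠ w : IsDedekindDomain.HeightOneSpectrum (NumberField.RingOfIntegers F) in Filter.cofinite, ∃ α : Multiset ℂ, π₀.1.HasSatakeParamAt w α ∧ ι (x (𝒰.ordT w 1)) = ((Real.sqrt (w.residueCard : ℝ) : ℝ) : ℂ) * α.esymm 1 ∧ ι (x (𝒰.ordT w 2)) = α.esymm 2 := by
  sorry

/-- **Stub 4 — the unramified Satake dictionary (normalisation check of the whole route).**  If `x` is
associated with `ρ` (`charpoly ρ(Frob_w^{arith}) = X² − x(T_{w,1})X + q_w x(T_{w,2})`, `heckeFrobPoly`) and its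
eigenvalues are those of a regular algebraic cuspidal `π₀` in the normalisation of `HasSatakeParamAt` at almost
all `w`, then the L-algebraic cuspidal `π := π₀^∨ ⊗ |det|^{1/2}` (contragredient: Satake `α ↦ α⁻¹`, for `n = 2`
equivalently the twist by the inverse central character; Borel–Jacquet twist: `α ↦ q^{-1/2}α`; C-algebraic ↦
L-algebraic, Buzzard–Gee) satisfies the summit's `SatakeFrobCompatibleAt ι π ρ w` at almost all `w`:
`(X − ι⁻¹(q^{1/2}α₁))(X − ι⁻¹(q^{1/2}α₂)) = arithFrobPolyOfSatake ι q 1 (q^{-1/2}α⁻¹)`. Size M.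
[cite: BuzzardGeeLMS2014, Def. 3.1.1 and §5.3] [cite: BorelJacquet1979, 5.7] [cite: GeeNewton2020, §3.3, Conj. 3.3.2] -/
theorem stub_satakeDictionary : ∀ (F : Type) [Field F] [NumberField F], NumberField.IsTotallyComplex F → Module.finrank ℚ F = 2 → ∀ (p : ℕ) [Fact p.Prime], p ≠ 2 → ∀ (hcpt : Literature.NumberTheory.Automorphic.isCompact_glFiniteIntegralLevel 2 F) (ι : PadicAlgCl p ≃+* ℂ) (ρ : Literature.NumberTheory.GaloisRepresentations.FramedGaloisRep F (PadicAlgCl p) 2) (𝒰 : Literature.NumberTheory.Automorphic.BigHeckeGLn.TameLevel 2 F p) (x : Literature.NumberTheory.Automorphic.OrdinaryHeckeAlgebraGLn 𝒰 →+* PadicAlgCl p) (π₀ : Literature.NumberTheory.Automorphic.CuspidalAutomorphicRepData 2 F hcpt), 𝒰.IsOrdAssociated x ρ → π₀.1.IsRegularAlgebraic → (∀ᶠ w : IsDedekindDomain.HeightOneSpectrum (NumberField.RingOfIntegers F) in Filter.cofinite, ∃ α : Multiset ℂ, π₀.1.HasSatakeParamAt w α ∧ ι (x (𝒰.ordT w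 1)) = ((Real.sqrt (w.residueCard : ℝ) : ℝ) : ℂ) * α.esymm 1 ∧ ι (x (𝒰.ordT w 2)) = α.esymm 2) → ∃ π : Literature.NumberTheory.Automorphic.CuspidalAutomorphicRepData 2 F hcpt, π.1.IsLAlgebraic ∧ ∀ᶠ v : IsDedekindDomain.HeightOneSpectrum (NumberField.RingOfIntegers F) in Filter.cofinite, Summit.Langlands.SatakeFrobCompatibleAt ι π.1 ρ v := by
  sorry

/-! ## 2. Checks against the landed Negative lemmas -/

/-- `hunr` is decoration (landed `eventually_isUnramifiedAt_of_isPadicallyAutomorphic`): no stub of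
this line needs the a.e.-unramified hypothesis beyond passing it to stub 1. [folklore] -/
theorem hunr_redundant {F : Type} [Field F] [NumberField F] {p : ℕ} [Fact p.Prime]
    {ρ : FramedGaloisRep F (PadicAlgCl p) 2} (hpm : ∃ 𝒰 : TameLevel 2 F p, 𝒰.IsPadicallyAutomorphic ρ) :
    ∀ᶠ v in cofinite, ρ.IsUnramifiedAt v := by
  obtain ⟨𝒰, h𝒰⟩ := hpm
  exact eventually_isUnramifiedAt_of_isPadicallyAutomorphic 𝒰 h𝒰

/-! ## 3. The composition: the six stubs imply the crux BY NAME (pure logic, no `sorry` of its own) -/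

/-- **The crux from the registered stubs.** Stub 1 gives an ordinary point `x` at a level maximal above `p`;
stubs 2a + 2b + glue give its dominant diamond weight; stub 3 a regular algebraic cuspidal `π₀` matching `x`;
stub 4 the L-algebraic `π` with the summit's Satake–Frobenius clause. [folklore] -/
theorem ProModularOrdinaryClassical_proof : ProModularOrdinaryClassical := by
  intro F _ _ hF hdeg p _ hp hcpt ι ρ hirr hunr hpm hord
  obtain ⟨𝒰, h𝒰, x, hx, hass⟩ := stub_ordinaryFactorisation F hF hdeg p hp ρ hirr hunr hpm hord
  obtain ⟨k, hk, m, hm, hv⟩ := hord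
  have hcen := stub_centralDiamondWeight F hF hdeg p hp ρ 𝒰 x k m hirr h𝒰 hx hass hk hm hv
  have hslot := stub_slotZeroDiamondWeight F hF hdeg p hp ρ 𝒰 x k m hirr h𝒰 hx hass hk hm hv
  have hdom : HasDominantDiamondWeight 𝒰 x k :=
    stub_dominantOfCentralAndSlotZero F p 𝒰 x k h𝒰 hcen hslot
  obtain ⟨π₀, hreg, hmatch⟩ :=
    stub_dominantPointsClassical F hF hdeg p hp hcpt ι ρ 𝒰 x k m hirr h𝒰 hx hass hk hm hv hdom
  exact stub_satakeDictionary F hF hdeg p hp hcpt ι ρ 𝒰 x π₀ hass hreg hmatch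

end

end Summit.Langlands.Langlands.Cruxes.ProModularOrdinaryClassical.TopDegreeExactControl
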